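import Literature.MathematicalPhysics.QuantumFieldTheory.Balaban1983to89.B6Eq217BlockSystem
import Literature.MathematicalPhysics.QuantumFieldTheory.Balaban1983to89.B6Eq226CovarianceMoments

/-!
# `Balaban1983to89.B6Eq226BlockSystem` — T. Bałaban, *Propagators and renormalization transformations for lattice
# gauge theories. II*, Commun. Math. Phys. **96** (1984) 223–250 [Balaban1984PropagatorsII], Sect. A (2.25)–(2.27)
# pp. 226–227 ON THE CARRIER OF RECORD: for the CONCRETE operators `Q′`, `Δ = ∂*∂`, `Δ′_a`, `G′ = Δ′_a⁻¹`,
# `(Q′G′²Q′*)⁻¹` of every block system (`…B6SectABlockSystem`/`…B6Eq217BlockSystem`, p21, on r03's `…B6Eq211.BlockSystem`)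
# the covariance of the Gaussian integral (2.25) — its second moments against ANY Lebesgue measure on `N(Q′)` — IS
# `𝒢 = G′² − G′²Q′*(Q′G′²Q′*)⁻¹Q′G′²` (2.27) and `R = Δ𝒢Δ` (2.26), with NO hypothesis left but the printed (2.3)–(2.4)

statement-level skeleton of published theorems with citation tags; proofs where landed; nothing here is a claim about the Yang–Mills mass gap

PDF held: `paper:balaban1984-cmp96-propagators-rt-ii` (journal page = PDF page + 222); pp. 224–227 read AS IMAGES on the
×2 renders `run/shared/lean/pub/pub-balaban/b2b-balaban-ref1/pages/1984-cmp96-propagators-rt-II/…-p002…p005-x2.png`.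

CITATION HEADER (lean-in-tree rule).  WHAT IS REPRODUCED: lit-balaban SKELETON rows **B6.Eq2.24** / **B6.Eq2.27**
((2.25)–(2.27) pp. 226–227), KIND model instance: the abstract theorems of record are `…B6Eq226CovarianceMoments.cov225`
/ `eq226_gaussian` / `eq227_gaussian` / `eq217_gaussian` (this seat, gen 6), whose letters `Δ`, `Q′`, `Q′*`, `a`, `G′`,
`E = (Q′G′²Q′*)⁻¹` and hypotheses (symmetry, adjointness, (2.11), the inverse identities) are DISCHARGED here by p21's
constructions `lap`, `Qp`, `Qps`, `aOp`, `green`, `cOp` (`…B6SectABlockSystem` p246192 / `…B6Eq217BlockSystem`) on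
r03's carrier of record `…B6Eq211.BlockSystem` (p242700), under the printed geometric facts (2.3)–(2.4) (`Cover`,
`BlocksOffZero`) and positive weights.  PHASE-2 proof seat p22 (gen 6), unit `lit-balaban-p22-g6`; owner r03, referee
ref-4; HOME `run/shared/lean/pub/lit-balaban/`.  Theorems only; nothing restated (p21's ALGEBRAIC (2.26)–(2.27),
`…B6Eq217BlockSystem.eq226`/`eq227`, are the companions: there `𝒢` is the formula (2.27); here `𝒢` is the covariance
of the Gaussian (2.25) and the formula is DERIVED).

PRINT (pp. 226–227, verbatim): *"e^{½⟨f,Rf⟩} = Z′⁻¹∫dλδ(Q′λ)e^{−½‖Δλ‖²+⟨Δf,λ⟩}. (2.25) Let us denote by 𝒢 a covariance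
of the Gaussian integral on the right-hand side above. Thus we have R = Δ𝒢Δ. (2.26) It is easy to see that
𝒢 = G′² − G′²Q′*(Q′G′²Q′*)⁻¹Q′G′². (2.27) This formula, the equality (2.26) and the equalities Q′𝒢 = 𝒢Q′* = 0 imply
the representation (2.17)."*

CONTENTS.  `qggq_symm`, `cOp_symm` (`Q′G′²Q′*` and its inverse are symmetric), `cov225_exists_blockSystem` (`Z′ > 0` and
a covariance exists, for every additive Haar measure on `N(Q′)`), **`cov225_blockSystem`** (for every covariance `T` of
(2.25): `T` maps into `N(Q′)`, is symmetric, `T(Δ²λ) = λ` on `N(Q′)`, the right-hand side of (2.25) with a general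
source is `e^{½⟨J,TJ⟩}Z′`, **`T = 𝒢` of (2.27)**, and **(2.26) `R = ΔTΔ`** for the orthogonal projection `R` onto
`ΔN(Q′)`), `eq217_blockSystem_gaussian` ((2.17) reached by the printed Gaussian chain; p21's `eq217` is the direct route).
Unit `lit-balaban-p22` (PHASE-2 proof seat, gen 6), HOME `run/shared/lean/pub/lit-balaban/`, 2026-08-21.
-/

namespace Literature.MathematicalPhysics.QuantumFieldTheory.Balaban1983to89.B6Eq226BlockSystem

open MeasureTheory B6SectABlockSystem B6Eq217BlockSystem
open scoped InnerProductSpace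
open B6Eq211 (BlockSystem)

noncomputable section

variable {ι κ β : Type*} (S : BlockSystem ι κ β) [Fintype ι] [Fintype β] [DecidablePred (· ∈ S.zeroSet)]
  [Fintype κ] [DecidableEq κ]

/-- `Q′G′²Q′*` is symmetric (`G′` symmetric, `Q′*` the adjoint of `Q′`). [cite: Balaban1984PropagatorsII, p.225 after (2.17)] -/
theorem qggq_symm {w : AvgIdx S → ℝ} (hw : ∀ i, 0 < w i) (hcover : Cover S) (x y : EuclideanSpace ℝ (AvgIdx S)) :
    ⟪qggq S hw hcover x, y⟫_ℝ = ⟪x, qggq S hw hcover y⟫_ℝ := by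
  simp only [qggq, LinearMap.comp_apply]
  rw [← inner_Qps_right, green_symm, green_symm, inner_Qps_left]

/-- `(Q′G′²Q′*)⁻¹` is symmetric (the inverse of a symmetric operator). [cite: Balaban1984PropagatorsII, p.225 after (2.17)] -/
theorem cOp_symm {w : AvgIdx S → ℝ} (hw : ∀ i, 0 < w i) (hcover : Cover S) (hdisj : BlocksOffZero S)
    (x y : EuclideanSpace ℝ (AvgIdx S)) :
    ⟪cOp S hw hcover hdisj x, y⟫_ℝ = ⟪x, cOp S hw hcover hdisj y⟫_ℝ := by
  conv_lhs => rw [← qggq_cOp S hw hcover hdisj y]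
  rw [← qggq_symm, qggq_cOp]

/-- **`Z′ > 0` and a covariance of (2.25) EXISTS on every covering block system**, for every additive Haar (Lebesgue)
measure `μ′` on `N(Q′)` ("`dλ δ(Q′λ)`"): `Z′ = ∫dλδ(Q′λ)e^{−½‖Δλ‖²} > 0` and there is `T` with
`⟨a,Tb⟩·Z′ = ∫dλδ(Q′λ)e^{−½‖Δλ‖²}⟨λ,a⟩⟨λ,b⟩` ((2.11) discharged by `lap_injOn_gauge`). [cite: Balaban1984PropagatorsII, (2.25) p.226] -/
theorem cov225_exists_blockSystem (hcover : Cover S) (μ' : Measure ↥(B6SectA.gaugeSpace (Qp S)))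
    [μ'.IsAddHaarMeasure] :
    0 < ∫ l : ↥(B6SectA.gaugeSpace (Qp S)), Real.exp (-(1 / 2) * ‖lap S (l : EuclideanSpace ℝ ι)‖ ^ 2) ∂μ' ∧
    ∃ T : EuclideanSpace ℝ ι →ₗ[ℝ] EuclideanSpace ℝ ι, ∀ a b : EuclideanSpace ℝ ι,
      ⟪a, T b⟫_ℝ * ∫ l : ↥(B6SectA.gaugeSpace (Qp S)), Real.exp (-(1 / 2) * ‖lap S (l : EuclideanSpace ℝ ι)‖ ^ 2) ∂μ' =
        ∫ l : ↥(B6SectA.gaugeSpace (Qp S)), Real.exp (-(1 / 2) * ‖lap S (l : EuclideanSpace ℝ ι)‖ ^ 2) *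
          (⟪(l : EuclideanSpace ℝ ι), a⟫_ℝ * ⟪(l : EuclideanSpace ℝ ι), b⟫_ℝ) ∂μ' :=
  B6Eq226CovarianceMoments.cov225_exists (Qp S) μ' (lap S) (lap_symm S) (lap_injOn_gauge S hcover)

/-- **(2.25)–(2.27) BY THE GAUSSIAN ROUTE ON EVERY BLOCK SYSTEM.**  For a covering block system with blocks off `Λ₀`
((2.3)–(2.4)) and positive weights, ANY additive Haar measure `μ′` on `N(Q′) = ker Q′` and ANY covariance `T` of the
Gaussian integral (2.25) (second moments: `⟨a,Tb⟩·Z′ = ∫dλδ(Q′λ)e^{−½‖Δλ‖²}⟨λ,a⟩⟨λ,b⟩`): (i) `T` maps into `N(Q′)`,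
(ii) `T` is symmetric, (iii) `T(Δ²λ) = λ` on `N(Q′)`, (iv) `∫dλδ(Q′λ)e^{−½‖Δλ‖²+⟨λ,J⟩} = e^{½⟨J,TJ⟩}Z′` for every `J`,
(v) **`T = G′² − G′²Q′*(Q′G′²Q′*)⁻¹Q′G′²` (2.27)** for p21's `G′ = green`, `(Q′G′²Q′*)⁻¹ = cOp`, and (vi) **(2.26)
`Rf = Δ(T(Δf))`** for the orthogonal projection `R` onto `ΔN(Q′)` — every hypothesis of
`…B6Eq226CovarianceMoments.cov225`/`eq227_gaussian`/`eq226_gaussian` discharged. [cite: Balaban1984PropagatorsII, (2.25)–(2.27) pp.226–227] -/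
theorem cov225_blockSystem {w : AvgIdx S → ℝ} (hw : ∀ i, 0 < w i) (hcover : Cover S) (hdisj : BlocksOffZero S)
    (μ' : Measure ↥(B6SectA.gaugeSpace (Qp S))) [μ'.IsAddHaarMeasure]
    (T : EuclideanSpace ℝ ι →ₗ[ℝ] EuclideanSpace ℝ ι)
    (hT : ∀ a b : EuclideanSpace ℝ ι,
      ⟪a, T b⟫_ℝ * ∫ l : ↥(B6SectA.gaugeSpace (Qp S)), Real.exp (-(1 / 2) * ‖lap S (l : EuclideanSpace ℝ ι)‖ ^ 2) ∂μ' =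
        ∫ l : ↥(B6SectA.gaugeSpace (Qp S)), Real.exp (-(1 / 2) * ‖lap S (l : EuclideanSpace ℝ ι)‖ ^ 2) *
          (⟪(l : EuclideanSpace ℝ ι), a⟫_ℝ * ⟪(l : EuclideanSpace ℝ ι), b⟫_ℝ) ∂μ') :
    (∀ u, T u ∈ B6SectA.gaugeSpace (Qp S)) ∧ (∀ x y, ⟪T x, y⟫_ℝ = ⟪x, T y⟫_ℝ) ∧
      (∀ n ∈ B6SectA.gaugeSpace (Qp S), T (lap S (lap S n)) = n) ∧
      (∀ J, ∫ l : ↥(B6SectA.gaugeSpace (Qp S)),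
          Real.exp (-(1 / 2) * ‖lap S (l : EuclideanSpace ℝ ι)‖ ^ 2 + ⟪(l : EuclideanSpace ℝ ι), J⟫_ℝ) ∂μ' =
        Real.exp ((1 / 2) * ⟪J, T J⟫_ℝ) *
          ∫ l : ↥(B6SectA.gaugeSpace (Qp S)), Real.exp (-(1 / 2) * ‖lap S (l : EuclideanSpace ℝ ι)‖ ^ 2) ∂μ') ∧
      T = B6SectA.calG (green S hw hcover) (Qp S) (Qps S) (cOp S hw hcover hdisj) ∧
      ∀ f, (lapGauge S).starProjection f = lap S (T (lap S f)) := by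
  obtain ⟨h1, h2, h3, h4⟩ :=
    B6Eq226CovarianceMoments.cov225 (Qp S) μ' (lap S) (lap_symm S) (lap_injOn_gauge S hcover) T hT
  refine ⟨h1, h2, h3, h4, ?_, fun f => ?_⟩
  · exact B6Eq226CovarianceMoments.eq227_gaussian (Qp S) μ' (lap S) (lap_symm S) (lap_injOn_gauge S hcover) T hT
      (Qps S) (aOp S w) (green S hw hcover) (cOp S hw hcover hdisj) (fun ω v => inner_Qps_left S ω v)
      (aOp_symm S w) (green_symm S hw hcover) (cOp_symm S hw hcover hdisj) (green_comp_deltaP S hw hcover)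
      (qggq_comp_cOp S hw hcover hdisj)
  · exact B6Eq226CovarianceMoments.eq226_gaussian (Qp S) μ' (lap S) (lap_symm S) (lap_injOn_gauge S hcover) T hT
      (lapGauge S) rfl ((lapGauge S).starProjection : EuclideanSpace ℝ ι →ₗ[ℝ] EuclideanSpace ℝ ι)
      (fun _ => rfl) f

/-- **(2.17) reached by the printed Gaussian chain on every block system:** *"This formula, the equality (2.26) and
the equalities Q′𝒢 = 𝒢Q′* = 0 imply the representation (2.17)"* — `R = I − G′Q′*(Q′G′²Q′*)⁻¹Q′G′` for the orthogonal
projection onto `ΔN(Q′)`, via any covariance of (2.25); p21's `…B6Eq217BlockSystem.eq217` is the direct route.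
[cite: Balaban1984PropagatorsII, (2.26)–(2.27) ⇒ (2.17) p.227] -/
theorem eq217_blockSystem_gaussian {w : AvgIdx S → ℝ} (hw : ∀ i, 0 < w i) (hcover : Cover S)
    (hdisj : BlocksOffZero S) (μ' : Measure ↥(B6SectA.gaugeSpace (Qp S))) [μ'.IsAddHaarMeasure]
    (T : EuclideanSpace ℝ ι →ₗ[ℝ] EuclideanSpace ℝ ι)
    (hT : ∀ a b : EuclideanSpace ℝ ι,
      ⟪a, T b⟫_ℝ * ∫ l : ↥(B6SectA.gaugeSpace (Qp S)), Real.exp (-(1 / 2) * ‖lap S (l : EuclideanSpace ℝ ι)‖ ^ 2) ∂μ' =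
        ∫ l : ↥(B6SectA.gaugeSpace (Qp S)), Real.exp (-(1 / 2) * ‖lap S (l : EuclideanSpace ℝ ι)‖ ^ 2) *
          (⟪(l : EuclideanSpace ℝ ι), a⟫_ℝ * ⟪(l : EuclideanSpace ℝ ι), b⟫_ℝ) ∂μ') (f : EuclideanSpace ℝ ι) :
    (lapGauge S).starProjection f =
      B6SectA.repr217 (green S hw hcover) (Qp S) (Qps S) (cOp S hw hcover hdisj) f :=
  B6Eq226CovarianceMoments.eq217_gaussian (Qp S) μ' (lap S) (lap_symm S) (lap_injOn_gauge S hcover) T hT (Qps S)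
    (aOp S w) (green S hw hcover) (cOp S hw hcover hdisj) (fun ω v => inner_Qps_left S ω v) (aOp_symm S w)
    (green_symm S hw hcover) (cOp_symm S hw hcover hdisj) (deltaP_comp_green S hw hcover)
    (green_comp_deltaP S hw hcover) (qggq_comp_cOp S hw hcover hdisj) (cOp_comp_qggq S hw hcover hdisj)
    (lapGauge S) rfl ((lapGauge S).starProjection : EuclideanSpace ℝ ι →ₗ[ℝ] EuclideanSpace ℝ ι) (fun _ => rfl) f

end

end Literature.MathematicalPhysics.QuantumFieldTheory.Balaban1983to89.B6Eq226BlockSystem
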